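import Literature.Probability.LatticeModels.SahiThirdOrderCorrelation
import Literature.Probability.Percolation.StrongHarrisThreePoint
import HarnessLib

/-!
# Sahi's third-order functional on the three pairwise-CONNECTION events of three vertices is trivially nonnegative

Topic `Literature/Probability/Percolation`.  Companion of `SahiThreePointSeparation.lean` (the DEcreasing triple
`{a↮b},{a↮c},{b↮c}`, where `E₃ ≥ 0` is prim-lit-2's four-switching theorem `3PT-LB`, tree
`ThreePointLB.sahiE3_pairSep_nonneg`).  For the INcreasing triple `{a↔b},{a↔c},{b↔c}` the instance of
[Kahn2022, Conjecture 5] (Sahi's `C₃`, `2μ(ABC) − Σμ(A)μ(BC) + μ(A)μ(B)μ(C) ≥ 0` for increasing `A,B,C` under a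
product measure) holds for a trivial reason, recorded here: with the five three-point cells `t = μ(abc)`,
`u₃ = μ(ab|c)`, `u₂ = μ(ac|b)`, `u₁ = μ(a|bc)`, `q = μ(a|b|c)` (`q + u₁ + u₂ + u₃ + t = 1`), transitivity of connection
gives `μ({a↔b}∩{b↔c}) = μ({a↔b}∩{a↔c}∩{b↔c}) = t` etc., and
`E₃({a↔b},{a↔c},{b↔c}) = 2t − t(x+y+z) + xyz` (`x = t+u₃, y = t+u₂, z = t+u₁`) is, after homogenising with
`(q+u₁+u₂+u₃+t) = 1`, a cubic with NONNEGATIVE coefficients in the five cells: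
`Σᵢ uᵢt² + Σᵢ uᵢ²t + 3Σ_{i<j} uᵢuⱼt + u₁u₂u₃ + qt² + 3qt·Σuᵢ + 2q²t`.  So this instance carries no information
(unlike the separation triple); prim-ineq-gen-8 (2026-08-20), noticed by the certificate LP returning the empty program set.
[cite: Kahn2022, Conjecture 5 (arXiv p. 3)]
-/

namespace Literature.Probability.Percolation

open MeasureTheory Literature.Probability.LatticeModels

variable {V : Type*} [Finite V]

/-- **Sahi's `E₃ ≥ 0` for the three pairwise-connection events of three vertices** (an instance of
[Kahn2022, Conjecture 5] for increasing events; here trivial: the homogenised cubic has nonnegative coefficients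
in the five three-point cells). [cite: Kahn2022, Conjecture 5 (arXiv p. 3)] -/
theorem prodBernoulli_sahiE3_pairConn_nonneg (w : Sym2 V → unitInterval) (a b c : V) :
    0 ≤ sahiE3 (prodBernoulli w) (openConn a b) (openConn a c) (openConn b c) := by
  classical
  set μ := prodBernoulli w with hμ
  set Eab : Set (BondConfig V) := openConn a b with hEab
  set Eac : Set (BondConfig V) := openConn a c with hEac
  set Ebc : Set (BondConfig V) := openConn b c with hEbc
  have mEab : MeasurableSet Eab := MeasurableSet.of_discrete
  have mEac : MeasurableSet Eac := MeasurableSet.of_discrete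
  have mEbc : MeasurableSet Ebc := MeasurableSet.of_discrete
  -- transitivity: all pairwise intersections are the 'all joined' cell T
  set T : Set (BondConfig V) := Eab ∩ Eac with hT
  have hT₁ : Eab ∩ Ebc = T := by
    ext ω; constructor
    · rintro ⟨hab, hbc⟩; exact ⟨hab, SimpleGraph.Reachable.trans hab hbc⟩
    · rintro ⟨hab, hac⟩; exact ⟨hab, SimpleGraph.Reachable.trans (SimpleGraph.Reachable.symm hab) hac⟩
  have hT₂ : Eac ∩ Ebc = T := by
    ext ω; constructor
    · rintro ⟨hac, hbc⟩; exact ⟨SimpleGraph.Reachable.trans hac (SimpleGraph.Reachable.symm hbc), hac⟩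
    · rintro ⟨hab, hac⟩; exact ⟨hac, SimpleGraph.Reachable.trans (SimpleGraph.Reachable.symm hab) hac⟩
  have hT₃ : Eab ∩ Eac ∩ Ebc = T := by rw [Set.inter_assoc, hT₂, hT, ← Set.inter_assoc, Set.inter_self]
  set x := μ.real Eab with hx
  set y := μ.real Eac with hy
  set z := μ.real Ebc with hz
  set t := μ.real T with ht
  -- the cells are nonnegative: u₃ = x - t, u₂ = y - t, u₁ = z - t, q = 1 - x - y - z + 2t
  have u₃ : 0 ≤ x - t := by
    have h := measureReal_inter_add_sdiff (μ := μ) (s := Eab) mEac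
    rw [Set.sdiff_eq] at h
    have : 0 ≤ μ.real (Eab ∩ Eacᶜ) := measureReal_nonneg
    linarith
  have u₂ : 0 ≤ y - t := by
    have h := measureReal_inter_add_sdiff (μ := μ) (s := Eac) mEab
    rw [Set.sdiff_eq, Set.inter_comm Eac Eab] at h
    have : 0 ≤ μ.real (Eac ∩ Eabᶜ) := measureReal_nonneg
    linarith
  have u₁ : 0 ≤ z - t := by
    have h := measureReal_inter_add_sdiff (μ := μ) (s := Ebc) mEab
    rw [Set.sdiff_eq, Set.inter_comm Ebc Eab, hT₁] at h
    have : 0 ≤ μ.real (Ebc ∩ Eabᶜ) := measureReal_nonneg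
    linarith
  have hq : 0 ≤ 1 - x - y - z + 2 * t := by
    have hU : μ.real (Eab ∪ Eac) = x + y - t := by
      have h := measureReal_union_add_inter (μ := μ) (s := Eab) mEac
      linarith
    have hU3 : μ.real (Eab ∪ Eac ∪ Ebc) = x + y + z - 2 * t := by
      have h := measureReal_union_add_inter (μ := μ) (s := Eab ∪ Eac) mEbc
      have hI : (Eab ∪ Eac) ∩ Ebc = T := by
        rw [Set.union_inter_distrib_right, hT₁, hT₂, Set.union_self]
      rw [hI] at h
      linarith
    have h1 : μ.real (Eab ∪ Eac ∪ Ebc) ≤ 1 := measureReal_le_one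
    linarith
  have ht0 : 0 ≤ t := measureReal_nonneg
  -- E₃ in terms of x, y, z, t
  have hE : sahiE3 μ Eab Eac Ebc = 2 * t - t * (x + y + z) + x * y * z := by
    rw [sahiE3_def, hT₃, hT₂, hT₁]
    ring
  rw [hE]
  -- homogenise with S = q + u₁ + u₂ + u₃ + t = 1 and read off a nonnegative combination of cell products
  set q := 1 - x - y - z + 2 * t with hqdef
  have hS : q + (z - t) + (y - t) + (x - t) + t = 1 := by rw [hqdef]; ring
  have key : 2 * t - t * (x + y + z) + x * y * z =
      2 * t * (q + (z - t) + (y - t) + (x - t) + t) ^ 2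
        - t * (x + y + z) * (q + (z - t) + (y - t) + (x - t) + t) + x * y * z := by
    rw [hS]; ring
  rw [key]
  nlinarith [mul_nonneg (mul_nonneg u₁ u₂) u₃, mul_nonneg (mul_nonneg u₁ u₂) ht0, mul_nonneg (mul_nonneg u₁ u₃) ht0,
    mul_nonneg (mul_nonneg u₂ u₃) ht0, mul_nonneg (mul_nonneg u₁ ht0) ht0, mul_nonneg (mul_nonneg u₂ ht0) ht0,
    mul_nonneg (mul_nonneg u₃ ht0) ht0, mul_nonneg (mul_nonneg u₁ u₁) ht0, mul_nonneg (mul_nonneg u₂ u₂) ht0,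
    mul_nonneg (mul_nonneg u₃ u₃) ht0, mul_nonneg (mul_nonneg hq ht0) ht0, mul_nonneg (mul_nonneg hq u₁) ht0,
    mul_nonneg (mul_nonneg hq u₂) ht0, mul_nonneg (mul_nonneg hq u₃) ht0, mul_nonneg (mul_nonneg hq hq) ht0]

end Literature.Probability.Percolation
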